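import Literature.NumberTheory.Automorphic.TorusCharacterSplitRigidity
import HarnessLib

/-!
# Rigidity of automorphic characters of `T = U(1)_{K/F₀}` from the split places — the one-place-per-pair and the
# torus-local (`ξ_v`) currencies

Topic `NumberTheory/Automorphic`; namespace `Literature.NumberTheory.Automorphic.UnitaryGroup`.  PROOF FILE (theorems only; no
definition, no named fact, no instance, no notation, no `sorry`), sequel of ★ `TorusCharacterSplitRigidity`
(`torusCharacter_eq_of_split`: two automorphic characters `ψ, ψ′` of `T(𝔸_{F₀}) = TorusDict.torus c` whose base changes have the
same local component at every `c`-MOVED finite place `w` of `K` are equal).  Here the two re-spellings consumers meet: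

* §1 `torusCharacter_eq_of_split'` — ONE place in each pair `{w, c • w}` above a split `v` suffices: the components at `w` and at
  `c • w` of a base change determine each other, `χ̃_{c • w} (c_w a) = χ̃_w (a)⁻¹` (★ `pullback_localComponent_smul`, the split-place
  convention lemma of ★ `TorusCharacterLocalComponents`).
* §2 `torusCharacter_eq_of_torusLocalComponent_eq_of_split` — the TORUS-LOCAL currency: equal local components
  `ξ_v = ξ′_v : T(F₀,v) → ℂˣ` (★ `torusLocalComponent v ψ = ψ ∘ (T(F₀,v) ↪ T(𝔸_{F₀}))`, the `η₁/η₂` slots of ★ `cmXiTorusChar`) at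
  every finite place `v` of `F₀` SPLIT in `K` (some place of `K` above `v` is moved by `c`) force `ψ = ψ′`; and the `ψ = 1` form.
  The bridge is the local dictionary ★ `pullback_semilocalComponent` (`χ̃_v (u) = ξ_v ((c ⊗ 1) u / u)`) at the semi-local unit with a
  single non-trivial coordinate (`semilocalUnits_piUnits_symm_mulSingle`).

## References
* J. W. S. Cassels, A. Fröhlich (eds.), *Algebraic Number Theory* (1967), Ch. II §6, Ch. VII (Tate) §4 Prop. 4.1 [CasselsFrohlichANT1967].
* V. Platonov, A. Rapinchuk, *Algebraic Groups and Number Theory* (1994), §7.3 Prop. 7.8 [PlatonovRapinchuk1994].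
* J. Rogawski, *Automorphic Representations of Unitary Groups in Three Variables* (1990), §12.2 pp. 173–174 (`ξ_v` at a split `v`)
  [Rogawski1990].
-/

set_option autoImplicit false

noncomputable section

open NumberField IsDedekindDomain
open Literature.NumberTheory.GaloisRepresentations
open Literature.NumberTheory.Automorphic.Arthur2013.Leaves.TECR

namespace Literature.NumberTheory.Automorphic

namespace UnitaryGroup

variable {F₀ K : Type} [Field F₀] [NumberField F₀] [Field K] [NumberField K] [Algebra F₀ K]
  (c : K ≃ₐ[F₀] K) (h2 : Module.finrank F₀ K = 2) (hc : c ≠ 1)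

/-! ## §1 One place in each pair `{w, c • w}` suffices -/

/-- **One place in each pair `{w, c • w}` suffices**: the local components of a base change at `w` and at `c • w` determine
each other (★ `pullback_localComponent_smul`: `χ̃_{c • w} (c_w a) = χ̃_w (a)⁻¹`), so it is enough to test, for every moved
`w`, the component at `w` OR the component at `c • w`. [cite: Rogawski1990, §12.2 pp. 173–174] [cite: CasselsFrohlichANT1967, Ch.
VII §4 Prop. 4.1] -/
theorem torusCharacter_eq_of_split' (ψ ψ' : ↥(TorusDict.torus c) →ₜ* ℂˣ) (hψ : TorusDict.IsAutomorphic c ψ)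
    (hψ' : TorusDict.IsAutomorphic c ψ')
    (h : ∀ w : HeightOneSpectrum (𝓞 K), c • w ≠ w →
      (TorusDict.pullback c h2 hc ψ hψ).localComponent w = (TorusDict.pullback c h2 hc ψ' hψ').localComponent w ∨
        (TorusDict.pullback c h2 hc ψ hψ).localComponent (c • w) =
          (TorusDict.pullback c h2 hc ψ' hψ').localComponent (c • w)) :
    ψ = ψ' := by
  refine torusCharacter_eq_of_split c h2 hc ψ ψ' hψ hψ' fun w hw => ?_
  rcases h w hw with hwe | hcw
  · exact hwe
  · refine MonoidHom.ext fun a => ?_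
    have key := DFunLike.congr_fun hcw (galAdicCompletionUnitsEquiv (L := K) c rfl a)
    rw [pullback_localComponent_smul K c h2 hc ψ hψ w a, pullback_localComponent_smul K c h2 hc ψ' hψ' w a] at key
    exact inv_injective key


/-! ## §2 The torus-local currency `ξ_v` -/

open scoped Classical in
/-- The semi-local unit with one prescribed component: `semilocalUnits v u = localUnits w a` for the unit `u` of
`∏_{w′ ∣ v} K_{w′}` equal to `a` at `w` and `1` elsewhere. [cite: TateThesis1967, §3.2] -/
theorem semilocalUnits_piUnits_symm_mulSingle {v : HeightOneSpectrum (𝓞 F₀)} (w : PlacesOver K v)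
    (a : (w.1.adicCompletion K)ˣ) :
    semilocalUnits K v ((MulEquiv.piUnits (M := fun w' : PlacesOver K v => w'.1.adicCompletion K)).symm
      (Pi.mulSingle w a)) = localUnits w.1 a := by
  rw [semilocalUnits_apply, MulEquiv.apply_symm_apply, Finset.prod_eq_single_of_mem w (Finset.mem_univ w)
    fun w' _ hw' => by rw [Pi.mulSingle_eq_of_ne hw', map_one]]
  rw [Pi.mulSingle_eq_same]

include h2 hc in
/-- **RIGIDITY FROM THE SPLIT PLACES (torus-local currency `ξ_v`).**  Two automorphic characters `ψ, ψ′` of `T(𝔸_{F₀})` with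
the same local component `ξ_v = ξ′_v : T(F₀,v) → ℂˣ` (★ `torusLocalComponent`) at every finite place `v` of `F₀` that SPLITS in
`K` (some, equivalently every, place of `K` above `v` is moved by `c`) are equal.
[cite: CasselsFrohlichANT1967, Ch. VII §4 Prop. 4.1 (proof); Ch. II §6] [cite: PlatonovRapinchuk1994, §7.3 Prop. 7.8] -/
theorem torusCharacter_eq_of_torusLocalComponent_eq_of_split (ψ ψ' : ↥(TorusDict.torus c) →ₜ* ℂˣ)
    (hψ : TorusDict.IsAutomorphic c ψ) (hψ' : TorusDict.IsAutomorphic c ψ')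
    (h : ∀ v : HeightOneSpectrum (𝓞 F₀), (∃ w : PlacesOver K v, c • w.1 ≠ w.1) →
      torusLocalComponent K c v ψ = torusLocalComponent K c v ψ') :
    ψ = ψ' := by
  classical
  refine torusCharacter_eq_of_split c h2 hc ψ ψ' hψ hψ' fun w hw => MonoidHom.ext fun a => ?_
  set W : PlacesOver K (w.under (𝓞 F₀)) := ⟨w, rfl⟩ with hW
  set u : (LocalRing K (w.under (𝓞 F₀)))ˣ :=
    (MulEquiv.piUnits (M := fun w' : PlacesOver K (w.under (𝓞 F₀)) => w'.1.adicCompletion K)).symm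
      (Pi.mulSingle W a) with hu
  have hv := h (w.under (𝓞 F₀)) ⟨W, hw⟩
  have e1 := pullback_semilocalComponent K c h2 hc ψ hψ u
  have e2 := pullback_semilocalComponent K c h2 hc ψ' hψ' u
  rw [semilocalComponent_apply, hu, semilocalUnits_piUnits_symm_mulSingle] at e1 e2
  rw [HeckeCharacter.localComponent_apply, HeckeCharacter.localComponent_apply, e1, e2, hv]

include h2 hc in
/-- The `ψ = 1` form in the torus-local currency: an automorphic character of `T(𝔸_{F₀})` with trivial local component at
every split place is trivial. [cite: CasselsFrohlichANT1967, Ch. VII §4 Prop. 4.1 (proof)] [cite: PlatonovRapinchuk1994, §7.3 Prop. 7.8] -/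
theorem torusCharacter_eq_one_of_torusLocalComponent_eq_one_of_split (ψ : ↥(TorusDict.torus c) →ₜ* ℂˣ)
    (hψ : TorusDict.IsAutomorphic c ψ)
    (h : ∀ v : HeightOneSpectrum (𝓞 F₀), (∃ w : PlacesOver K v, c • w.1 ≠ w.1) → torusLocalComponent K c v ψ = 1) :
    ψ = 1 :=
  torusCharacter_eq_of_torusLocalComponent_eq_of_split c h2 hc ψ 1 hψ (fun _ _ => rfl) fun v hv => by
    rw [h v hv]; rfl

end UnitaryGroup

end Literature.NumberTheory.Automorphic

end
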